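import Summits.QuantumFields.YangMills.Theorems.BalabanUVNodesK0RecordFormatNamesFluct

/-!
# K0⁷ — EDITION 15b: the (1.5)-FAITHFUL Δ₁ at the record — CRIT-1 g34's RULING (R3′)-Δ₁ (nodeO STATUS 2026-08-31T01:47:09Z) applied append-only; ERRATUM E-DEF1-g34-5

ERRATUM E-DEF1-g34-5 (DEF-1 gen 34, on ed.15 `…K0RecordFormatNamesFluct` ✓p801852): the name `recordΔ1 F K U` of ed.15 is PRINT's BARE HESSIAN `Δ(U_k) = K` of the Wilson action in the
exponential chart ([13] = [Balaban1985BackgroundPropagators] (3.10)∕(3.12) p.392), NOT print's `Δ₁` of (3.127) p.421, which is `Δ₁ = K − 2𝒞`, `⟨A, 𝒞 A′⟩ = ⟨H(U_k) C^{(2)}(A, A′), J(U_k)⟩` (H =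
the LINEAR-constraint minimiser (3.126), C^{(2)} = the second-order part of the FINE averaging (3.14), J = the current (3.11)); [I] (1.5) p.261 «the operators H_{1,j}, Δ₁ are defined in
Sect. D [13]».  Hence ed.15's `recordQuadData` (field `Δ₁ := bilinOf (recordΔ1 …)`) and `recordS ∕ recordPrec ∕ recordZk ∕ recordLogZk` are the 𝒞-LESS variants, NOT (1.5)'s form.  THIS FILE
(append-only cure, CRIT-1's naming order): `recordHessA` = the bare Hessian under its honest name; `recordΔ1π 𝒞 := recordHessA − 2·𝒞` with `𝒞` a DISPLAYED PARAMETER (its record body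
`pairJ ∘ recordH ∘ recordC₂fine` needs the [13] §D objects `recordH` (3.126), `recordC₂fine` (3.14) — NOT cut here, said); and the (1.5)-faithful family `recordQuadDataΔ1 ∕ recordSΔ1 ∕
recordPrecΔ1 ∕ recordZkΔ1 ∕ recordLogZkΔ1`.  Also flagged (ruling (B)): ed.15's `recordH1` is the Landau projection w.r.t. the FLAT background ((21)∕[B6] (2.12), N(Q′)-normalisation);
print's H₁ at `U_k ≠ 1` obeys the R-weighted BACKGROUND Landau condition `R D*_{U_k} A = 0` ([13] (3.17)–(3.19)) — the covariant `recordH1cov` belongs to the edition that names `recordH`.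
`--kind definition --supports stmt-QuantumFields-20541 --as helper`; count-neutral.  [I] = [Balaban1987RG1], [13] = [Balaban1985BackgroundPropagators].

HONEST FRAMING.  Definitions only; nothing of Bałaban asserted, ported or discharged; positivity of `Cᵀ S C`, existence of D̃, (2.1) = (2.12) NOT asserted; 27930⁸ OPEN; K0⁷∕K-Ax OPEN; NODE O 0∕1;
COUNT 8∕28 · K 1∕4 UNMOVED; finite `𝕋⁴_{L^K}` at fixed ε — NOT continuum ∕ ℝ⁴ ∕ OS; **the Yang–Mills mass gap (Clay) is NOT proved by any of this.**  No `sorry`, `instance`, `notation`.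
-/

noncomputable section

open scoped BigOperators Matrix.Norms.L2Operator

namespace Summit.QuantumFields.YangMills.Theorems.K0RecordFormatNames

open Literature.MathematicalPhysics.QuantumFieldTheory.Balaban1983to89
open Literature.MathematicalPhysics.QuantumFieldTheory.Balaban1983to89.Node00
open Literature.MathematicalPhysics.QuantumFieldTheory.Balaban1983to89.T4Continuum (T4Family)
open _root_.Matrix

variable (F : T4Family)

/-- **`Δ(U_k) = K` — THE BARE HESSIAN of the Wilson action at `U` in the exponential chart, under its honest name** (= ed.15's `recordΔ1`, E-DEF1-g34-5).
[cite: Balaban1985BackgroundPropagators, (3.10) p.392, (3.12) p.392] -/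
def recordHessA (K : ℕ) (U : GaugeField (F.P K) 0 (SU 2)) : (FineIdx F K → ℝ) →ₗ[ℝ] (FineIdx F K → ℝ) →ₗ[ℝ] ℝ :=
  bilinOf (recordΔ1 F K U)

/-- `recordHessA` IS ed.15's `recordΔ1` read as a bilinear map (`rfl`). [cite: Balaban1985BackgroundPropagators, (3.12) p.392 (bookkeeping)] -/
theorem recordHessA_eq (K : ℕ) (U : GaugeField (F.P K) 0 (SU 2)) : recordHessA F K U = bilinOf (recordΔ1 F K U) := rfl

/-- **PRINT's `Δ₁(U_k) = K − 2𝒞`** ((3.127): `⟨A, Δ₁A′⟩ = ⟨A, Δ(U_k)A′⟩ − 2⟨H(U_k) C^{(2)}(A, A′), J(U_k)⟩`), with the 𝒞-form a DISPLAYED PARAMETER (record body = `pairJ ∘ recordH ∘ recordC₂fine`,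
the [13] §D objects (3.126)∕(3.14) at the record — not named yet).  Sign per (3.127)'s «−» (tree READING NOTE `B9Eq3112` :106–:110). [cite: Balaban1985BackgroundPropagators, (3.127) p.421; Balaban1987RG1, (1.5) p.261] -/
def recordΔ1π (K : ℕ) (U : GaugeField (F.P K) 0 (SU 2)) (𝒞 : (FineIdx F K → ℝ) →ₗ[ℝ] (FineIdx F K → ℝ) →ₗ[ℝ] ℝ) :
    (FineIdx F K → ℝ) →ₗ[ℝ] (FineIdx F K → ℝ) →ₗ[ℝ] ℝ :=
  recordHessA F K U - (2 : ℝ) • 𝒞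

/-- **THE (1.5) DATUM, Δ₁-FAITHFUL**: ed.15's `recordQuadData` with the field `Δ₁ := recordΔ1π F K U 𝒞` (print's Δ₁), `𝒞` and `hopLin` displayed parameters.
[cite: Balaban1987RG1, (1.5) p.261; Balaban1985BackgroundPropagators, (3.127) p.421] -/
def recordQuadDataΔ1 (k K : ℕ) (εbg : ℝ) (U : GaugeField (F.P K) 0 (SU 2)) (Vk : GaugeField (F.P K) k (SU 2))
    (𝒞 : (FineIdx F K → ℝ) →ₗ[ℝ] (FineIdx F K → ℝ) →ₗ[ℝ] ℝ) (hopLin : (PBond (F.P K) (k + 1) → MatA 2) →ₗ[ℝ] (FluctIdx F k K → ℝ)) :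
    B12Eq15QuadraticForm.Data ℝ (FluctIdx F k K → ℝ) (FineIdx F K → ℝ) (PBond (F.P K) (k + 1) → MatA 2) where
  H := (recordH1 F k K εbg Vk).toLinearMap
  Δ₁ := recordΔ1π F K U 𝒞
  hop := hopLin
  C₂ := bilinOf (recordC2 F k K Vk)
  pairJ := (recordPairJop F K U).toLinearMap
  G₂ := bilinOf (recordG₂ F k K Vk)

/-- **The matrix `S` of (1.5)'s `Δ^{(k)}(U)`, Δ₁-faithful.** [cite: Balaban1987RG1, (1.4)–(1.5) pp.260–261] -/
def recordSΔ1 (k K : ℕ) (εbg : ℝ) (U : GaugeField (F.P K) 0 (SU 2)) (Vk : GaugeField (F.P K) k (SU 2))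
    (𝒞 : (FineIdx F K → ℝ) →ₗ[ℝ] (FineIdx F K → ℝ) →ₗ[ℝ] ℝ) (hopLin : (PBond (F.P K) (k + 1) → MatA 2) →ₗ[ℝ] (FluctIdx F k K → ℝ)) :
    Matrix (FluctIdx F k K) (FluctIdx F k K) ℝ :=
  LinearMap.toMatrix₂' ℝ (recordQuadDataΔ1 F k K εbg U Vk 𝒞 hopLin).form

/-- **`Cᵀ S C`, Δ₁-faithful** — the `T` of `B10LogDet63.matrix63` for the LZ half (positivity = a THEOREM, not asserted). [cite: Balaban1987RG1, p.268, (1.4) p.260] -/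
def recordPrecΔ1 (k K : ℕ) (εbg : ℝ) (U : GaugeField (F.P K) 0 (SU 2)) (Vk : GaugeField (F.P K) k (SU 2))
    (𝒞 : (FineIdx F K → ℝ) →ₗ[ℝ] (FineIdx F K → ℝ) →ₗ[ℝ] ℝ) (hopLin : (PBond (F.P K) (k + 1) → MatA 2) →ₗ[ℝ] (FluctIdx F k K → ℝ)) :
    Matrix (Fin (Module.finrank ℝ (fluctKer F k K Vk))) (Fin (Module.finrank ℝ (fluctKer F k K Vk))) ℝ :=
  (recordCop F k K Vk)ᵀ * recordSΔ1 F k K εbg U Vk 𝒞 hopLin * recordCop F k K Vk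

/-- **`Z^{(k)}(U)` by (1.4), Δ₁-faithful.** [cite: Balaban1987RG1, (1.4) p.260] -/
def recordZkΔ1 (k K : ℕ) (εbg : ℝ) (U : GaugeField (F.P K) 0 (SU 2)) (Vk : GaugeField (F.P K) k (SU 2))
    (𝒞 : (FineIdx F K → ℝ) →ₗ[ℝ] (FineIdx F K → ℝ) →ₗ[ℝ] ℝ) (hopLin : (PBond (F.P K) (k + 1) → MatA 2) →ₗ[ℝ] (FluctIdx F k K → ℝ)) : ℝ :=
  B12Eq15QuadraticForm.Z14 (recordSΔ1 F k K εbg U Vk 𝒞 hopLin) (recordCop F k K Vk)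

/-- **`log Z^{(k)}(U)`, Δ₁-faithful** (D-defB-2's slot). [cite: Balaban1987RG1, (1.3)–(1.4) p.260] -/
def recordLogZkΔ1 (k K : ℕ) (εbg : ℝ) (U : GaugeField (F.P K) 0 (SU 2)) (Vk : GaugeField (F.P K) k (SU 2))
    (𝒞 : (FineIdx F K → ℝ) →ₗ[ℝ] (FineIdx F K → ℝ) →ₗ[ℝ] ℝ) (hopLin : (PBond (F.P K) (k + 1) → MatA 2) →ₗ[ℝ] (FluctIdx F k K → ℝ)) : ℝ :=
  Real.log (recordZkΔ1 F k K εbg U Vk 𝒞 hopLin)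

/-- With `𝒞 := 0` the Δ₁-faithful datum IS ed.15's 𝒞-less one (`recordQuadData`) — so the ed.15 names are exactly the `𝒞 = 0` variants (bookkeeping). [cite: Balaban1987RG1, (1.5) p.261 (bookkeeping)] -/
theorem recordQuadDataΔ1_zero (k K : ℕ) (εbg : ℝ) (U : GaugeField (F.P K) 0 (SU 2)) (Vk : GaugeField (F.P K) k (SU 2))
    (hopLin : (PBond (F.P K) (k + 1) → MatA 2) →ₗ[ℝ] (FluctIdx F k K → ℝ)) :
    recordQuadDataΔ1 F k K εbg U Vk 0 hopLin = recordQuadData F k K εbg U Vk hopLin := by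
  have h : recordΔ1π F K U 0 = bilinOf (recordΔ1 F K U) := by
    ext x y
    simp [recordΔ1π, recordHessA]
  simp only [recordQuadDataΔ1, recordQuadData, h]

end Summit.QuantumFields.YangMills.Theorems.K0RecordFormatNames

end
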